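import Summits.CriticalPhenomena.PercolationContinuityZ3.Theorems.Transplant.KNLevelsDefs
import HarnessLib

/-!
# F5 (generic), part 2 — Kozma–Nitzan Lemma 10, Steps I–II over levels: nested-level geometry, the hypotheses `LHyp`, the failure levels
# and the events `H_{t,j}`, `A_t` (generalises `L/KozmaNitzanTargetLemma.lean` ll. 643–897 from `zdGraph d` to a graph with levels)

builds on p205010 (kernel theorem, internal audit signed; external expert review pending) — nothing in this file uses p205010.
Lane `prim-bschramm`, seat `prim-bschramm-p3` (task F5-prod); helper file (`--supports stmt-CriticalPhenomena-4575 --as helper`).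

Continuation of `KNLevelsDefs`.  The two LEVEL AXIOMS — `Monotone L.X` and `∂^{out} (X j) ⊆ X (j+1)` — replace every use of the
arithmetic of `Icc (lo - j) (hi + j)` in the original (`Icc_enlarge_mono`, `outerBoundary_enlarge_subset`,
`not_mem_innerBoundary_of_enlarge_succ_subset`, `Icc_subset_enlarge`):
* §1 nested-level geometry: `notMem_innerBoundary_of_succ_subset` (a vertex of level `j` is never on the inner boundary of a set containing
  level `j+1`), contact edges of a higher level are pairs of a lower region (`cEdges_subset_wireSet_region`), locality of `D_{j'}` (`Djo_congr`);
* §2 the failure levels `failAbove`, the events `Hev` (`H_{t,j}`) and `Aev` (`A_t = G_1 ∩ ⋯ ∩ G_t` of KN (17)–(18)): `Hev_subset_Aev`,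
  `Hev_pairwiseDisjoint`, `Hev_congr` — verbatim from the original;
* §3 the hypotheses `LHyp L W p D R` of Lemma 10 relative to the level data (level axioms, subbox `D ⊇ X (R+1)`, finite support, `o ∉ D`)
  and their consequences: levels and their outer boundaries lie in `D` off `∂^{in} D`, contact edges carry weight `p` (`W_cEdge`), and
  **`{o ↔ B}` forces an open contact edge at every level `j ≤ R`** (`reachB_subset_Djo`, KN p. 18 "X > k₂ implies G_1 ∩ ⋯ ∩ G_{k₂}").
The probability estimates ((18), `P(A_t) ≤ (1-(1-p)^{ΔN})^t`, Step II) are part 3 (`KNLevelsStepII`).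

[cite: KozmaNitzan2024, §4 Lemma 10, p. 18 (Step II) — the ℤ^d model] [cite: GrimmettPercolation1999, §7.2]
-/

noncomputable section

open MeasureTheory ProbabilityTheory
open scoped ENNReal

namespace Summit.CriticalPhenomena.PercolationContinuityZ3.Theorems

namespace Transplant

namespace KNLevels

open Literature.Probability.Percolation Literature.Probability.LatticeModels SimpleGraph

variable {V : Type*} [DecidableEq V] {G : SimpleGraph V} [G.LocallyFinite]

namespace LData

variable {L : LData G}

/-! ## §1 Nested-level geometry -/

/-- **Nested levels**: a vertex of level `j` is not on the inner boundary of any finite set containing level `j+1` (its neighbours lie in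
`X j ∪ ∂^{out} X j ⊆ X (j+1)`). Replaces `not_mem_innerBoundary_of_enlarge_succ_subset`. [cite: KozmaNitzan2024, §4 p. 15 (B⟨R⟩, ∂B)] -/
theorem notMem_innerBoundary_of_succ_subset (hmono : Monotone L.X) (hnest : ∀ j, outerBoundary G (L.X j) ⊆ L.X (j + 1))
    {j : ℕ} {S : Finset V} (hS : L.X (j + 1) ⊆ S) {y : V} (hy : y ∈ L.X j) : y ∉ innerBoundary G S := by
  intro h
  rw [mem_innerBoundary_iff] at h
  obtain ⟨-, x, hxS, hyx⟩ := h
  have hx1 : x ∉ L.X (j + 1) := fun h' => hxS (hS h')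
  have hxj : x ∉ L.X j := fun h' => hx1 (hmono (Nat.le_succ j) h')
  exact hx1 (hnest j (mem_outerBoundary_iff.2 ⟨hxj, y, hy, hyx.symm⟩))

/-- The outer boundary of level `j` lies in every higher level. [folklore] -/
theorem outerBoundary_subset_of_lt (hmono : Monotone L.X) (hnest : ∀ j, outerBoundary G (L.X j) ⊆ L.X (j + 1))
    {j j' : ℕ} (h : j < j') : outerBoundary G (L.X j) ⊆ L.X j' :=
  (hnest j).trans (hmono (Nat.succ_le_of_lt h))

/-- Contact edges at a level `j' > j`, from vertices in the support, ARE pairs of the region outside `B⟨j⟩` (provided `B⟨j'⟩ ⊆ Sfin`).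
[folklore] -/
theorem cEdges_subset_wireSet_region (hmono : Monotone L.X) (hnest : ∀ j, outerBoundary G (L.X j) ⊆ L.X (j + 1))
    {j j' : ℕ} (hjj' : j < j') (hX : L.X j' ⊆ L.Sfin)
    {κ : Finset V} (hκ : κ ⊆ outerBoundary G (L.X j')) (hκS : κ ⊆ L.Sfin)
    {e : Sym2 V} (he : e ∈ L.cEdges j' κ) : e ∈ wireSet (L.region j) := by
  obtain ⟨x, hx, y, hy, hxy, rfl⟩ := mem_cEdges_iff.1 he
  have hxout : x ∉ L.X j' := (mem_outerBoundary_iff.1 (hκ hx)).1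
  rw [mk_mem_wireSet_iff]
  refine ⟨⟨fun h' => hxout (hmono hjj'.le (Finset.mem_coe.1 h')), Finset.mem_coe.2 (hκS hx)⟩,
    ⟨fun h' => ?_, Finset.mem_coe.2 (hX hy)⟩, hxy.ne⟩
  -- `y ∈ B⟨j⟩` is impossible: `y` is an inner-boundary vertex of `B⟨j'⟩`
  have hyb : y ∈ innerBoundary G (L.X j') := by
    rw [mem_innerBoundary_iff]; exact ⟨hy, x, hxout, hxy.symm⟩
  exact notMem_innerBoundary_of_succ_subset hmono hnest (hmono (Nat.succ_le_of_lt hjj')) (Finset.mem_coe.1 h') hyb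

/-- **Locality of `D_{j'}` seen from a lower level `j`.** [folklore] -/
theorem Djo_congr (hmono : Monotone L.X) (hnest : ∀ j, outerBoundary G (L.X j) ⊆ L.X (j + 1))
    {j j' : ℕ} (hjj' : j < j') (hX : L.X j' ⊆ L.Sfin) {ω ω' : BondConfig V}
    (h : ∀ e ∈ wireSet (L.region j), e ∈ ω ↔ e ∈ ω') : ω ∈ L.Djo j' ↔ ω' ∈ L.Djo j' := by
  simp only [Djo, Set.mem_setOf_eq]
  have hK : L.Kont j' ω = L.Kont j' ω' := Kont_congr fun e he => h e (wireSet_region_anti (hmono hjj'.le) he)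
  rw [hK]
  refine exists_congr fun e => and_congr_right fun he => h e ?_
  exact cEdges_subset_wireSet_region hmono hnest hjj' hX (Kont_subset _ _) (fun x hx => mem_Sfin_of_mem_Kont hx) he

/-! ## §2 The failure levels and the events `H_{t,j}`, `A_t` -/

variable (L)

open Classical in
/-- The failure levels of `J` strictly above `j`. [cite: KozmaNitzan2024, §4 p. 18 (the levels j_i)] -/
def failAbove (N : ℕ) (J : Finset ℕ) (j : ℕ) (ω : BondConfig V) : Finset ℕ :=
  J.filter fun j' => j < j' ∧ ω ∈ L.Fail N j'

/-- `H_{t,j}`: level `j` is the `(t+1)`-st outermost failure level of `J`, and at the `t` failure levels above it a contact edge is open.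
[cite: KozmaNitzan2024, §4 p. 18 (the events G_i)] -/
def Hev (N : ℕ) (J : Finset ℕ) (t j : ℕ) : Set (BondConfig V) :=
  {ω | ω ∈ L.Fail N j ∧ (L.failAbove N J j ω).card = t ∧ ∀ j' ∈ J, j < j' → ω ∈ L.Fail N j' → ω ∈ L.Djo j'}

/-- `A_t`: the `t` outermost failure levels of `J` exist and at each of them a contact edge is open (`G_1 ∩ ⋯ ∩ G_t` of (18)).
[cite: KozmaNitzan2024, §4 p. 18 ((17)–(18))] -/
def Aev (N : ℕ) (J : Finset ℕ) : ℕ → Set (BondConfig V)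
  | 0 => Set.univ
  | t + 1 => ⋃ j ∈ J, (L.Hev N J t j ∩ L.Djo j)

variable {L}

/-- Membership in `failAbove`. [folklore] -/
theorem mem_failAbove_iff {N : ℕ} {J : Finset ℕ} {j j' : ℕ} {ω : BondConfig V} :
    j' ∈ L.failAbove N J j ω ↔ j' ∈ J ∧ j < j' ∧ ω ∈ L.Fail N j' := by
  classical
  rw [failAbove, Finset.mem_filter]

/-- Membership in `Hev`. [folklore] -/
theorem mem_Hev_iff {N : ℕ} {J : Finset ℕ} {t j : ℕ} {ω : BondConfig V} :
    ω ∈ L.Hev N J t j ↔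
      ω ∈ L.Fail N j ∧ (L.failAbove N J j ω).card = t ∧ ∀ j' ∈ J, j < j' → ω ∈ L.Fail N j' → ω ∈ L.Djo j' := Iff.rfl

/-- `A_0` is everything. [folklore] -/
theorem Aev_zero {N : ℕ} {J : Finset ℕ} : L.Aev N J 0 = Set.univ := rfl

/-- `A_{t+1} = ⋃_{j ∈ J} (H_{t,j} ∩ D_j)`. [folklore] -/
theorem Aev_succ {N : ℕ} {J : Finset ℕ} {t : ℕ} : L.Aev N J (t + 1) = ⋃ j ∈ J, (L.Hev N J t j ∩ L.Djo j) := rfl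

/-- Passing from a level to the lowest failure level above it removes exactly that level from the failure levels above. [folklore] -/
theorem failAbove_min' {N : ℕ} {J : Finset ℕ} {j : ℕ} {ω : BondConfig V}
    (hne : (L.failAbove N J j ω).Nonempty) :
    L.failAbove N J ((L.failAbove N J j ω).min' hne) ω = (L.failAbove N J j ω).erase ((L.failAbove N J j ω).min' hne) := by
  set s := L.failAbove N J j ω with hs
  set m := s.min' hne with hm
  have hm_mem : m ∈ s := Finset.min'_mem s hne
  ext j''
  rw [Finset.mem_erase, mem_failAbove_iff, mem_failAbove_iff]
  have hjm : j < m := (mem_failAbove_iff.1 (hs ▸ hm_mem)).2.1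
  constructor
  · rintro ⟨hJ, hmj, hF⟩
    exact ⟨ne_of_gt hmj, hJ, hjm.trans hmj, hF⟩
  · rintro ⟨hne', hJ, hjj, hF⟩
    refine ⟨hJ, lt_of_le_of_ne (Finset.min'_le s j'' ?_) (Ne.symm hne'), hF⟩
    rw [hs, mem_failAbove_iff]; exact ⟨hJ, hjj, hF⟩

/-- `H_{t,j} ⊆ A_t` for every `j` (the `t` outermost failure levels above `j` carry open contact edges). [folklore] -/
theorem Hev_subset_Aev {N : ℕ} {J : Finset ℕ} (t : ℕ) : ∀ j, L.Hev N J t j ⊆ L.Aev N J t := by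
  intro j
  cases t with
  | zero => intro ω _; exact Set.mem_univ ω
  | succ t =>
    rintro ω ⟨-, hcard, hD⟩
    have hne : (L.failAbove N J j ω).Nonempty := by
      rw [← Finset.card_pos, hcard]; exact Nat.succ_pos t
    set m := (L.failAbove N J j ω).min' hne with hm
    have hm_mem := Finset.min'_mem _ hne
    rw [← hm] at hm_mem
    obtain ⟨hmJ, hjm, hmF⟩ := mem_failAbove_iff.1 hm_mem
    simp only [Aev, Set.mem_iUnion, exists_prop]
    refine ⟨m, hmJ, ⟨hmF, ?_, fun j' hj' hmj' hF' => hD j' hj' (hjm.trans hmj') hF'⟩, hD m hmJ hjm hmF⟩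
    rw [hm, failAbove_min' hne, Finset.card_erase_of_mem (hm ▸ hm_mem), hcard]
    rfl

/-- The events `H_{t,j}`, `j ∈ J`, are pairwise disjoint. [folklore] -/
theorem Hev_pairwiseDisjoint {N : ℕ} {J : Finset ℕ} (t : ℕ) : (↑J : Set ℕ).PairwiseDisjoint (L.Hev N J t) := by
  have key : ∀ ⦃j j' : ℕ⦄, j < j' → j' ∈ J → Disjoint (L.Hev N J t j) (L.Hev N J t j') := by
    intro j j' hlt hj'
    rw [Set.disjoint_left]
    rintro ω ⟨hF, hcard, -⟩ ⟨hF', hcard', -⟩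
    -- `failAbove j' ⊆ (failAbove j).erase j'` and `j' ∈ failAbove j`
    have hmem : j' ∈ L.failAbove N J j ω := mem_failAbove_iff.2 ⟨hj', hlt, hF'⟩
    have hsub : L.failAbove N J j' ω ⊆ (L.failAbove N J j ω).erase j' := by
      intro j'' hj''
      obtain ⟨hJ, hlt', hF''⟩ := mem_failAbove_iff.1 hj''
      exact Finset.mem_erase.2 ⟨ne_of_gt hlt', mem_failAbove_iff.2 ⟨hJ, hlt.trans hlt', hF''⟩⟩
    have h1 : 0 < (L.failAbove N J j ω).card := Finset.card_pos.2 ⟨_, hmem⟩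
    have h2 := Finset.card_le_card hsub
    rw [Finset.card_erase_of_mem hmem] at h2
    rw [hcard] at h1 h2
    rw [hcard'] at h2
    omega
  intro j hj j' hj' hjj'
  change Disjoint (L.Hev N J t j) (L.Hev N J t j')
  rcases lt_or_gt_of_ne hjj' with h | h
  · exact key h (Finset.mem_coe.1 hj')
  · exact (key h (Finset.mem_coe.1 hj)).symm

/-- **Locality of `H_{t,j}`**: it is determined by the pairs of the region outside `B⟨j⟩`. [folklore] -/
theorem Hev_congr (hmono : Monotone L.X) (hnest : ∀ j, outerBoundary G (L.X j) ⊆ L.X (j + 1))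
    {N : ℕ} {J : Finset ℕ} (hXS : ∀ j' ∈ J, L.X j' ⊆ L.Sfin) {t j : ℕ}
    {ω ω' : BondConfig V} (h : ∀ e ∈ wireSet (L.region j), e ∈ ω ↔ e ∈ ω') :
    ω ∈ L.Hev N J t j ↔ ω' ∈ L.Hev N J t j := by
  classical
  have hfa : L.failAbove N J j ω = L.failAbove N J j ω' := by
    unfold failAbove
    refine Finset.filter_congr fun j' _ => ?_
    constructor
    · rintro ⟨hlt, hF⟩; exact ⟨hlt, (Fail_congr (hmono hlt.le) h).1 hF⟩
    · rintro ⟨hlt, hF⟩; exact ⟨hlt, (Fail_congr (hmono hlt.le) h).2 hF⟩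
  simp only [Hev, Set.mem_setOf_eq, hfa, Fail_congr (hmono le_rfl) h]
  refine and_congr_right fun _ => and_congr_right fun _ => forall₂_congr fun j' hj' => ?_
  refine forall_congr' fun hlt => ?_
  rw [Fail_congr (hmono hlt.le) h, Djo_congr hmono hnest hlt (hXS j' hj') h]

end LData

/-! ## §3 The hypotheses of Lemma 10 relative to the level data -/

/-- The hypotheses of Lemma 10 on the weighting, relative to the level data, over `G`: the two LEVEL AXIOMS (monotone levels, each
containing the outer boundary of the previous one — KN's `B⟨j⟩ ⊆ B⟨j+1⟩ ⊇ ∂B⟨j⟩`), a subbox `D ⊇ B⟨R+1⟩` of the finitely supported weighting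
`W` at parameter `p`, and a source `o ∈ Sfin \ D`. [cite: KozmaNitzan2024, §4 Lemma 10 (p. 17)] -/
structure LHyp (L : LData G) (W : Sym2 V → unitInterval) (p : unitInterval) (D : Finset V) (R : ℕ) : Prop where
  mono : Monotone L.X
  nest : ∀ j, outerBoundary G (L.X j) ⊆ L.X (j + 1)
  sub : IsSubbox G W p D
  fin : FinSupp W L.Sfin
  DS : D ⊆ L.Sfin
  encl : L.X (R + 1) ⊆ D
  o_not : L.o ∉ D
  o_mem : L.o ∈ L.Sfin

namespace LHyp

variable {L : LData G} {W : Sym2 V → unitInterval} {p : unitInterval} {D : Finset V} {R : ℕ}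
variable (hL : LHyp L W p D R)
include hL

/-- `B⟨j⟩ ⊆ D` for all `j ≤ R + 1`. [folklore] -/
theorem X_subset_D : ∀ ⦃j : ℕ⦄, j ≤ R + 1 → L.X j ⊆ D := fun _ hj => (hL.mono hj).trans hL.encl

/-- `B⟨j⟩ ⊆ Sfin` for all `j ≤ R + 1`. [folklore] -/
theorem X_subset_Sfin : ∀ ⦃j : ℕ⦄, j ≤ R + 1 → L.X j ⊆ L.Sfin := fun _ hj => (hL.X_subset_D hj).trans hL.DS

/-- The outer boundary of `B⟨j⟩` lies in `D` for `j ≤ R`. [folklore] -/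
theorem outerBoundary_X_subset_D {j : ℕ} (hj : j ≤ R) : outerBoundary G (L.X j) ⊆ D :=
  (hL.nest j).trans (hL.X_subset_D (by omega))

/-- No vertex of `B⟨j⟩`, `j ≤ R`, is an inner-boundary vertex of `D`. [folklore] -/
theorem not_mem_innerBoundary_D {j : ℕ} (hj : j ≤ R) {y : V} (hy : y ∈ L.X j) :
    y ∉ innerBoundary G D :=
  LData.notMem_innerBoundary_of_succ_subset hL.mono hL.nest (hL.X_subset_D (by omega)) hy

/-- **Contact edges carry weight `p`.** [cite: KozmaNitzan2024, §4 p. 18] -/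
theorem W_cEdge {j : ℕ} (hj : j ≤ R) {κ : Finset V} (hκ : κ ⊆ outerBoundary G (L.X j))
    {e : Sym2 V} (he : e ∈ L.cEdges j κ) : W e = p := by
  obtain ⟨x, hx, y, hy, hxy, rfl⟩ := LData.mem_cEdges_iff.1 he
  exact hL.sub.adj x (hL.outerBoundary_X_subset_D hj (hκ hx)) y (hL.X_subset_D (by omega) hy) hxy

/-- **`{o ↔ B}` forces an open contact edge at every level** (up to the null event `PosOnlyᶜ`): an open path from `o ∉ D` to
`B ⊆ B⟨j⟩` enters `B⟨j⟩` through an open pair of positive weight, which by the subbox property is an edge of `G` from an outer-boundary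
vertex. [cite: KozmaNitzan2024, §4 p. 18 ("X > k₂ implies G_1 ∩ ⋯ ∩ G_{k₂}")] -/
theorem reachB_subset_Djo {j : ℕ} (hj : j ≤ R) :
    L.reachB ∩ PosOnly W ⊆ L.Djo j := by
  rintro ω ⟨hreach, hpos⟩
  obtain ⟨b, hb, hob⟩ := LData.mem_reachB_iff.1 hreach
  -- an open path from `o` to `b`, inside `Sfin`
  have hpath : PathIn (openGraph ω) (↑L.Sfin : Set V) L.o b :=
    pathIn_of_posOnly hL.fin hpos hL.o_mem hob
  have hoX : L.o ∈ (↑(L.X j) : Set V)ᶜ := fun h' => hL.o_not (hL.X_subset_D (by omega) (Finset.mem_coe.1 h'))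
  have hbX : b ∉ (↑(L.X j) : Set V)ᶜ := fun h' => h' (Finset.mem_coe.2 (hL.mono (Nat.zero_le j) hb))
  obtain ⟨a, b', ha, hb', hb'S, hab, hpa⟩ := hpath.exit hoX hbX
  simp only [Set.mem_compl_iff, not_not, Finset.mem_coe] at hb'
  rw [openGraph_adj] at hab
  have hWpos : W s(a, b') ≠ 0 := hpos _ hab.1
  -- `a ∈ D` (else the weight would vanish by the subbox property)
  have haD : a ∈ D := by
    by_contra haD
    exact hWpos (hL.sub.outside b' (hL.X_subset_D (by omega) hb') (hL.not_mem_innerBoundary_D hj hb') a haD)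
  -- hence `a ∼ b'` in `G`
  have hadj : G.Adj a b' := by
    by_contra hna
    exact hWpos (hL.sub.nadj a haD b' (hL.X_subset_D (by omega) hb') hab.2 hna)
  have haout : a ∈ outerBoundary G (L.X j) := by
    rw [mem_outerBoundary_iff]; exact ⟨fun h' => ha (Finset.mem_coe.2 h'), b', hb', hadj⟩
  have haK : a ∈ L.Kont j ω := by
    rw [LData.mem_Kont_iff]
    refine ⟨haout, ?_⟩
    rw [DCT16.mem_openConnIn_iff_pathIn]
    exact hpa
  exact ⟨s(a, b'), LData.mem_cEdges_iff.2 ⟨a, haK, b', hb', hadj, rfl⟩, hab.1⟩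

/-- `H_{t,j}` is determined by the pairs of the region outside `B⟨j⟩` (all levels of `J` at most `R`). [folklore] -/
theorem determinedBy_Hev {N : ℕ} {J : Finset ℕ} (hJ : ∀ j' ∈ J, j' ≤ R) (t j : ℕ) :
    DeterminedBy (L.Hev N J t j) (wireSet (L.region j)) := by
  rw [determinedBy_iff]
  intro ω ω' hω
  refine LData.Hev_congr hL.mono hL.nest (fun j' hj' => hL.X_subset_Sfin (by have := hJ j' hj'; omega)) fun e he => ?_
  have := Set.ext_iff.1 hω e
  simp only [Set.mem_inter_iff] at this
  exact ⟨fun h' => (this.1 ⟨h', he⟩).1, fun h' => (this.2 ⟨h', he⟩).1⟩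

/-- `H_{t,j}` is measurable (all levels of `J` at most `R`). [folklore] -/
theorem measurableSet_Hev {N : ℕ} {J : Finset ℕ} (hJ : ∀ j' ∈ J, j' ≤ R) (t j : ℕ) : MeasurableSet (L.Hev N J t j) :=
  ((hL.determinedBy_Hev hJ t j).mono fun _ he => Finset.mem_coe.2 (L.mem_pairsF_of_mem_wireSet_region he)).measurableSet_of_finset

end LHyp

namespace LData

variable {L : LData G}

/-- `Fail N j` is determined by the pairs of the region outside `B⟨j⟩`. [folklore] -/
theorem determinedBy_Fail (N j : ℕ) : DeterminedBy (L.Fail N j) (wireSet (L.region j)) := by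
  rw [determinedBy_iff]
  intro ω ω' hω
  refine Fail_congr subset_rfl fun e he => ?_
  have := Set.ext_iff.1 hω e
  simp only [Set.mem_inter_iff] at this
  exact ⟨fun h' => (this.1 ⟨h', he⟩).1, fun h' => (this.2 ⟨h', he⟩).1⟩

/-- `Fail N j` is measurable for every level `j`. [folklore] -/
theorem measurableSet_Fail (N : ℕ) : ∀ j, MeasurableSet (L.Fail N j) := fun j =>
  ((determinedBy_Fail (L := L) N j).mono fun _ he => Finset.mem_coe.2 (L.mem_pairsF_of_mem_wireSet_region he)).measurableSet_of_finset

/-- `(Fail N j)ᶜ` is the event "at least `N` contact vertices at level `j`" (KN's `E_j`). [cite: KozmaNitzan2024, §4 p. 18 (E_j)] -/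
theorem compl_Fail_eq (N j : ℕ) : (L.Fail N j)ᶜ = {ω | N ≤ (L.Kont j ω).card} := by
  ext ω; simp only [Set.mem_compl_iff, Fail, Set.mem_setOf_eq, not_lt]

omit [DecidableEq V] [G.LocallyFinite] in
/-- `{o ↔ B}` is measurable (`V` countable). [folklore] -/
theorem measurableSet_reachB [Countable V] : MeasurableSet L.reachB :=
  Finset.measurableSet_biUnion _ fun _ _ => measurableSet_openConn_holds _ _

end LData

end KNLevels

end Transplant

end Summit.CriticalPhenomena.PercolationContinuityZ3.Theorems

end
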